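import Summits.NavierStokesRegularity.NavierStokesRegularity.Theorems.ScenarioCensusRotationOrder
import HarnessLib

/-!
# LINE «rotation-order» port, part 2/3: rows `Row_AirT` / `Row_AiaT` / `Row_AncT` / `Row_AsrT` / `Row_AsqT`, all PROVED; readings of the meter

Re-homed for the scenario census (typer seat ns-census-typer-1 g7; the cells are MEMBERS OF RECORD «DECIDED IN KERNEL IN FILES» of rows A9 / A13
since census v1.68 (lead g9; critic idea-crit-3 PASS + RE-STAMPs 18:37:11Z / 18:47:14Z / 18:52:59Z; ref ns-census-ref g8 PRE-CHECK ✓ §13.14 [1/6];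
lit §21.20); this port makes them TREE-decided): VERBATIM PORT of ns-idea-2 LINE g11-2 «rotation-order» REV 3,
`pub/ideators/ns-idea-2/lines/rotation-order/line-rotation-order.lean` sha16 5b02128187347f27 (744 l., lean check rc 0, 0 sorry), split for the 400-line rule
into `ScenarioCensusRotationOrder` (§0–§2: the rotations, the rotation-order group `stabAngles` and its dichotomy, slice-level conjugation, the
infinitesimal generator) → `…RotationOrderRows` (§3–§5: rows `Row_AirT` / `Row_AiaT` / `Row_AncT` / `Row_AsrT` / `Row_AsqT` + `_holds`, readings) →
`…RotationOrderAxis` (§6 / §6b: rigidity of the axis and of the scaling centre, `Row_ApaT` / `Row_AdsT` / `Row_Apa2T` + `_holds`; census KEYS).  Lean text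
VERBATIM in namespace `…Theorems.ScenarioCensus.RotationOrder` (the line's `…Lines.RotationOrder` re-homed); port edits: `local notation "E3"` → `abbrev E3`,
`[folklore]` dropped from the docstrings of the eight parameterless row `def`s (gate relocation rule), thirteen one-line docstrings added, the line's
`set_option linter.unusedVariables false` dropped (one proof lambda binds the unused `θ₀` as `_`).

No census VALUE is moved here (rows A9 / A13 keep their values; the members become TREE-decided by name); NS regularity is NOT proved; (L′) is
untouched; no summit statement is proved by this file.
-/

-- the summit and its single problem share the name `NavierStokesRegularity` (D-0017 nested layout)
set_option linter.dupNamespace false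

noncomputable section

open Set Function
open Literature.Analysis.FluidPDE
open Summit.NavierStokesRegularity.NavierStokesRegularity.Theorems

namespace Summit.NavierStokesRegularity.NavierStokesRegularity.Theorems.ScenarioCensus.RotationOrder

/-! ## §3  Rows -/

/-- **Row A-ir-T** («one irrational rotation», census block A, Type-I TIME-RATE class, fixed axis):
a Type-I ancient mild field whose every slice is equivariant under one rotation `R_{θ₀}` about `e₃`
with `θ₀/2π` irrational vanishes on the past. -/
def Row_AirT : Prop :=
  ∀ (C : ℝ) (u : ℝ → E3 → E3) (θ₀ : ℝ), IsTypeIAncientMild C u → Irrational (θ₀ / (2 * Real.pi)) →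
    (∀ t < 0, ∀ x, u t (rotZ θ₀ x) = rotZ θ₀ (u t x)) → ∀ t < 0, ∀ x, u t x = 0

/-- **Row A-ia-T** (any axis): the same under the rotation by `θ₀` about the axis through `c` with
direction `L⁻¹ e₃`, `x ↦ c + L⁻¹ R_{θ₀} L (x − c)`. -/
def Row_AiaT : Prop :=
  ∀ (C : ℝ) (u : ℝ → E3 → E3) (c : E3) (L : E3 ≃ₗᵢ[ℝ] E3) (θ₀ : ℝ), IsTypeIAncientMild C u →
    Irrational (θ₀ / (2 * Real.pi)) →
    (∀ t < 0, ∀ x, u t (c + L.symm (rotZ θ₀ (L (x - c)))) = L.symm (rotZ θ₀ (L (u t x)))) →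
    ∀ t < 0, ∀ x, u t x = 0

/-- **Row A-nc-T** (instrument form): a Type-I ancient mild field whose rotation-order group about
`e₃` is not cyclic vanishes. -/
def Row_AncT : Prop :=
  ∀ (C : ℝ) (u : ℝ → E3 → E3), IsTypeIAncientMild C u →
    (∀ a : ℝ, stabAngles u ≠ AddSubgroup.zmultiples a) → ∀ t < 0, ∀ x, u t x = 0

/-- **Row A-sr-T** (improper element of infinite order): equivariance of every slice under one
roto-reflection `S = R_{θ₀} ∘ σ_h` with `θ₀/π` irrational forces `u ≡ 0`. -/
def Row_AsrT : Prop :=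
  ∀ (C : ℝ) (u : ℝ → E3 → E3) (θ₀ : ℝ), IsTypeIAncientMild C u → Irrational (θ₀ / Real.pi) →
    (∀ t < 0, ∀ x, u t (rotZ θ₀ (reflH x)) = rotZ θ₀ (reflH (u t x))) → ∀ t < 0, ∀ x, u t x = 0

/-- **Row A-sq-T** (discrete SCREW of finite turn order): equivariance of every slice under one screw
motion `x ↦ R_{2πp/q} x + h e₃` with `q ≥ 1` and axial drift `h ≠ 0` forces `u ≡ 0` — its `q`-th power
is the pure translation by `qh e₃ ≠ 0` (census A13, tree `periodic_typeI_liouville_genuine`). -/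
def Row_AsqT : Prop :=
  ∀ (C : ℝ) (u : ℝ → E3 → E3) (p : ℤ) (q : ℕ) (h : ℝ), IsTypeIAncientMild C u → 1 ≤ q → h ≠ 0 →
    (∀ t < 0, ∀ x, u t (rotZ (2 * Real.pi * p / q) x + h • eZ) = rotZ (2 * Real.pi * p / q) (u t x)) →
    ∀ t < 0, ∀ x, u t x = 0

/-! ## §4  Proofs -/

/-- **ROW A-ia-T holds** (closure ⇒ axisymmetric about the axis ⇒ infinitesimal ⇒ stmt-14061). -/
theorem row_AiaT_holds : Row_AiaT := by
  intro C u c L θ₀ hu hθ hsym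
  have hinf : ∀ t < (0 : ℝ), ∀ x, fderiv ℝ (u t) x (conjGen L (x - c)) - conjGen L (u t x) = 0 :=
    fun t ht => infinitesimal_of_equivariant_irrational (hu.continuous_slice ht)
      ((hu.contDiff_slice ht).differentiable (by simp)) c L hθ (hsym t ht)
  exact AxisymEndLiouville_of C u hu c (conjGen L) 0 (inner_conjGen_self L) (conjGen_ne_zero L)
    le_rfl hinf

/-- **Backward-END form** (the shape of stmt-14061): equivariance under the irrational rotation about the
axis on an end `t < θ`, `θ ≤ 0`, forces vanishing on that end. [folklore] -/
theorem eq_zero_on_end_of_equivariant_irrational {C : ℝ} {u : ℝ → E3 → E3}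
    (hu : IsTypeIAncientMild C u) (c : E3) (L : E3 ≃ₗᵢ[ℝ] E3) {θ₀ θ : ℝ}
    (hθ₀ : Irrational (θ₀ / (2 * Real.pi))) (hθ : θ ≤ 0)
    (hsym : ∀ t < θ, ∀ x, u t (c + L.symm (rotZ θ₀ (L (x - c)))) = L.symm (rotZ θ₀ (L (u t x)))) :
    ∀ t < θ, ∀ x, u t x = 0 := by
  have hinf : ∀ t < θ, ∀ x, fderiv ℝ (u t) x (conjGen L (x - c)) - conjGen L (u t x) = 0 :=
    fun t ht => infinitesimal_of_equivariant_irrational (hu.continuous_slice (by linarith))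
      ((hu.contDiff_slice (by linarith)).differentiable (by simp)) c L hθ₀ (hsym t ht)
  exact AxisymEndLiouville_of C u hu c (conjGen L) θ (inner_conjGen_self L) (conjGen_ne_zero L) hθ hinf

/-- **ROW A-ir-T holds** (the standard axis). -/
theorem row_AirT_holds : Row_AirT := by
  intro C u θ₀ hu hθ hsym
  refine row_AiaT_holds C u 0 (LinearIsometryEquiv.refl ℝ E3) θ₀ hu hθ ?_
  intro t ht x
  simpa using hsym t ht x

/-- **ROW A-nc-T holds**: a non-cyclic rotation-order group is dense, closed, hence `ℝ`; then every
slice is axisymmetric, in particular `R_{θ}`-equivariant for an irrational turn. -/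
theorem row_AncT_holds : Row_AncT := by
  intro C u hu hnc
  have hc : ∀ t < 0, Continuous (u t) := fun t ht => hu.continuous_slice ht
  rcases stabAngles_dichotomy hc with htop | ⟨m, hm, hcyc⟩
  · -- every slice axisymmetric: use the irrational turn θ₀ = √2 · 2π? simpler: θ₀ := 2π·√2
    have hall := isAxisymmetric_of_stabAngles_eq_top htop
    have hθ : Irrational (Real.sqrt 2 * (2 * Real.pi) / (2 * Real.pi)) := by
      rw [mul_div_assoc, div_self (by positivity), mul_one]
      exact irrational_sqrt_two
    exact row_AirT_holds C u _ hu hθ fun t ht x => hall t ht _ x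
  · exact absurd hcyc (hnc _)

/-- **ROW A-sr-T holds**: `S² = R_{2θ₀}` and `2θ₀/2π = θ₀/π`. -/
theorem row_AsrT_holds : Row_AsrT := by
  intro C u θ₀ hu hθ hsym
  have h2 : ∀ t < 0, ∀ x, u t (rotZ (2 * θ₀) x) = rotZ (2 * θ₀) (u t x) := by
    intro t ht x
    have h1 := hsym t ht (rotZ θ₀ (reflH x))
    rw [hsym t ht x, rotoReflection_sq, rotoReflection_sq] at h1
    exact h1
  have hθ' : Irrational (2 * θ₀ / (2 * Real.pi)) := by
    rw [mul_div_mul_left _ _ (two_ne_zero)]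
    exact hθ
  exact row_AirT_holds C u (2 * θ₀) hu hθ' h2

/-- Iterating a screw symmetry: the `k`-th power is the screw `(R_{kθ}, kh e₃)`. [folklore] -/
theorem screw_iterate {u : ℝ → E3 → E3} {θ h t : ℝ}
    (hsym : ∀ x, u t (rotZ θ x + h • eZ) = rotZ θ (u t x)) :
    ∀ (k : ℕ) (x : E3), u t (rotZ (k * θ) x + (k * h) • eZ) = rotZ (k * θ) (u t x) := by
  intro k
  induction k with
  | zero => intro x; simp [rotZ_zero]
  | succ k ih =>
    intro x
    have h1 := hsym (rotZ (k * θ) x + (k * h) • eZ)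
    rw [ih x, ← rotZ_add, rotZ_add_smul_eZ, ← rotZ_add, add_assoc, ← add_smul] at h1
    have e1 : θ + k * θ = (↑(k + 1) : ℝ) * θ := by push_cast; ring
    have e2 : k * h + h = (↑(k + 1) : ℝ) * h := by push_cast; ring
    rw [e1, e2] at h1
    exact h1

/-- **ROW A-sq-T holds**: the `q`-th power of the screw is the translation by `qh e₃ ≠ 0`; a Type-I
ancient mild field with a non-zero spatial period vanishes (census A13, tree). -/
theorem row_AsqT_holds : Row_AsqT := by
  intro C u p q h hu hq hh hsym
  have hper : ∀ t < 0, ∀ x, u t (x + ((q : ℝ) * h) • eZ) = u t x := by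
    intro t ht x
    have h1 := screw_iterate (hsym t ht) q x
    have hq0 : (q : ℝ) ≠ 0 := by exact_mod_cast (by omega : q ≠ 0)
    have e : (q : ℝ) * (2 * Real.pi * p / q) = p * (2 * Real.pi) := by field_simp
    rw [e, rotZ_int_mul_two_pi, rotZ_int_mul_two_pi] at h1
    exact h1
  have hL : ((q : ℝ) * h) • (eZ : E3) ≠ 0 := by
    have hq0 : (q : ℝ) ≠ 0 := by exact_mod_cast (by omega : q ≠ 0)
    intro h0
    have h2 := congrArg (fun v : E3 => v 2) h0
    simp [eZ] at h2
    rcases h2 with h2 | h2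
    · exact absurd h2 (by omega)
    · exact hh h2
  exact ScenarioCensus.PeriodicGauge.periodic_typeI_liouville_genuine C u hu _ hL hper

/-! ## §5  Readings of the instrument -/

/-- **Finite order of a live profile**: a non-trivial Type-I ancient mild field has rotation-order
group `(2π/m)ℤ` about `e₃` for some `m ≥ 1` (the stratum `m = ∞` is empty). [folklore] -/
theorem order_finite_of_nontrivial {C : ℝ} {u : ℝ → E3 → E3} (hu : IsTypeIAncientMild C u)
    (hne : ∃ t < 0, ∃ x, u t x ≠ 0) :
    ∃ m : ℕ, 1 ≤ m ∧ stabAngles u = AddSubgroup.zmultiples (2 * Real.pi / m) := by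
  have hc : ∀ t < 0, Continuous (u t) := fun t ht => hu.continuous_slice ht
  rcases stabAngles_dichotomy hc with htop | h
  · obtain ⟨t, ht, x, hx⟩ := hne
    have hall := isAxisymmetric_of_stabAngles_eq_top htop
    have hθ : Irrational (Real.sqrt 2 * (2 * Real.pi) / (2 * Real.pi)) := by
      rw [mul_div_assoc, div_self (by positivity), mul_one]
      exact irrational_sqrt_two
    exact absurd (row_AirT_holds C u _ hu hθ (fun t ht x => hall t ht _ x) t ht x) hx
  · exact h

/-- **Lattice edge**: the any-axis row implies the fixed-axis row. [folklore] -/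
theorem row_AirT_of_row_AiaT (h : Row_AiaT) : Row_AirT := fun C u θ₀ hu hθ hsym =>
  h C u 0 (LinearIsometryEquiv.refl ℝ E3) θ₀ hu hθ fun t ht x => by simpa using hsym t ht x

/-- **Lattice edge**: the instrument row implies the irrational-rotation row (`θ₀, 2π ∈ 𝔄(u)` with
irrational ratio make `𝔄(u)` non-cyclic). [folklore] -/
theorem row_AirT_of_row_AncT (h : Row_AncT) : Row_AirT := fun C u _ hu hθ hsym =>
  h C u hu (not_cyclic_of_irrational (G := stabAngles u) hsym (two_pi_mem_stabAngles u) hθ)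

end Summit.NavierStokesRegularity.NavierStokesRegularity.Theorems.ScenarioCensus.RotationOrder

end
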